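import Summits.KontsevichZagierPeriods.KontsevichZagierPeriods.Theorems.TerasomaMultiplicationMultiplicationAccessibleCornerZetaGradGen
import Summits.KontsevichZagierPeriods.KontsevichZagierPeriods.Theorems.TerasomaMultiplicationMultiplicationAccessibleCornerIdentGen

/-!
# Closedness of the corner Stokes form in every dimension `p = n + 2` (structural route)

Crux `MultiplicationAccessible`, line `shifted-family-prime-sieve`, registered sub-goal `cornerClosedGen`:
the spelled components `Vθ i`, `Vy`, `Vv` of the `p`-form satisfy
`Σ_i ∂_{θ_i} Vθ i + ∂_y Vy − ∂_v Vv = 0` on `W`. Proof: the Liouville flux field `Y` on the cube is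
divergence free (`cornerFieldGen`); its adjugate pull-back `Ỹ` under the blow-up chart is divergence free
(`div_adj_eq_zero`); the `v`-extension `V_u = a(vZ) Z Ỹ`, `V_v = a(vZ) v ∇Z·Ỹ` satisfies
`Σ ∂V_u − ∂_v V_v = 0` (`vext_eq_zero`); and `V` coincides with the spelled components on `W`
(`cornerIdentGen`, `cornerZetaGradGen`).
-/

noncomputable section

open Finset Real
open scoped BigOperators Topology

namespace Summit.KontsevichZagierPeriods.TerasomaMultiplication.MultiplicationAccessible

namespace CornerClosedG

variable {n : ℕ}

/-- The chart domain `U` is open. [folklore] -/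
theorem isOpen_U : IsOpen {u : Fin (n + 2) → ℝ | (∀ i : Fin (n + 1), 0 < u (Fin.castSucc i)) ∧ ∑ i : Fin (n + 1), u (Fin.castSucc i) < 1 ∧ 0 < u (Fin.last (n + 1)) ∧ u (Fin.last (n + 1)) * (1 - ∑ i : Fin (n + 1), u (Fin.castSucc i)) < 1 ∧ ∀ i : Fin (n + 1), u (Fin.last (n + 1)) * u (Fin.castSucc i) < 1} := by
  have hc : ∀ j : Fin (n + 2), Continuous fun u : Fin (n + 2) → ℝ => u j := fun j => continuous_apply j
  have hs : Continuous fun u : Fin (n + 2) → ℝ => ∑ i : Fin (n + 1), u (Fin.castSucc i) :=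
    continuous_finsetSum _ fun i _ => hc _
  have hset : {u : Fin (n + 2) → ℝ | (∀ i : Fin (n + 1), 0 < u (Fin.castSucc i)) ∧ ∑ i : Fin (n + 1), u (Fin.castSucc i) < 1 ∧ 0 < u (Fin.last (n + 1)) ∧ u (Fin.last (n + 1)) * (1 - ∑ i : Fin (n + 1), u (Fin.castSucc i)) < 1 ∧ ∀ i : Fin (n + 1), u (Fin.last (n + 1)) * u (Fin.castSucc i) < 1} =
      (⋂ i : Fin (n + 1), {u : Fin (n + 2) → ℝ | 0 < u (Fin.castSucc i)}) ∩
      {u | ∑ i : Fin (n + 1), u (Fin.castSucc i) < 1} ∩ {u | 0 < u (Fin.last (n + 1))} ∩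
      {u | u (Fin.last (n + 1)) * (1 - ∑ i : Fin (n + 1), u (Fin.castSucc i)) < 1} ∩
      ⋂ i : Fin (n + 1), {u : Fin (n + 2) → ℝ | u (Fin.last (n + 1)) * u (Fin.castSucc i) < 1} := by
    ext u
    simp only [Set.mem_inter_iff, Set.mem_iInter, Set.mem_setOf_eq]
    tauto
  rw [hset]
  exact ((((isOpen_iInter_of_finite fun i => isOpen_lt continuous_const (hc _)).inter
    (isOpen_lt hs continuous_const)).inter (isOpen_lt continuous_const (hc _))).inter
    (isOpen_lt ((hc _).mul (continuous_const.sub hs)) continuous_const)).inter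
    (isOpen_iInter_of_finite fun i => isOpen_lt ((hc _).mul (hc _)) continuous_const)

/-- Coordinate slices stay in the open chart domain. [folklore] -/
theorem eventually_update_mem {u : Fin (n + 2) → ℝ} (hu : u ∈ {u : Fin (n + 2) → ℝ | (∀ i : Fin (n + 1), 0 < u (Fin.castSucc i)) ∧ ∑ i : Fin (n + 1), u (Fin.castSucc i) < 1 ∧ 0 < u (Fin.last (n + 1)) ∧ u (Fin.last (n + 1)) * (1 - ∑ i : Fin (n + 1), u (Fin.castSucc i)) < 1 ∧ ∀ i : Fin (n + 1), u (Fin.last (n + 1)) * u (Fin.castSucc i) < 1}) (j : Fin (n + 2)) :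
    ∀ᶠ b in 𝓝 (u j), Function.update u j b ∈ {u : Fin (n + 2) → ℝ | (∀ i : Fin (n + 1), 0 < u (Fin.castSucc i)) ∧ ∑ i : Fin (n + 1), u (Fin.castSucc i) < 1 ∧ 0 < u (Fin.last (n + 1)) ∧ u (Fin.last (n + 1)) * (1 - ∑ i : Fin (n + 1), u (Fin.castSucc i)) < 1 ∧ ∀ i : Fin (n + 1), u (Fin.last (n + 1)) * u (Fin.castSucc i) < 1} := by
  have hcont : Continuous fun b : ℝ => Function.update u j b := continuous_const.update j continuous_id
  have h0 : Function.update u j (u j) = u := Function.update_eq_self j u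
  exact hcont.continuousAt.preimage_mem_nhds (by rw [h0]; exact isOpen_U.mem_nhds hu)

end CornerClosedG

open CornerClosedG in
/-- **Closedness of the corner Stokes form, all `p = n + 2`** (registered sub-goal `cornerClosedGen`):
`Σ_i ∂_{θ_i}Vθ i + ∂_yVy − ∂_vVv = 0` on `W`, by the structural route (divergence-free flux field,
Piola pull-back, `v`-extension, identification). [cite: KontsevichZagier2001, §1.2] -/
theorem cornerClosedGen : ∀ (n : ℕ) (x s : ℚ), 2 ≤ x → 3 ≤ s → ∀ (Θ T : (Fin (n + 2) → ℝ) → Fin (n + 2) → ℝ) (Z S H K : (Fin (n + 2) → ℝ) → ℝ)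
      (M : (Fin (n + 2) → ℝ) → Fin (n + 2) → ℝ) (P : (Fin (n + 3) → ℝ) → ℝ),
    (∀ u, Θ u 0 = 1 - ∑ i : Fin (n + 1), u (Fin.castSucc i)) → (∀ u (i : Fin (n + 1)), Θ u i.succ = u (Fin.castSucc i)) →
    (∀ u k, T u k = 1 - u (Fin.last (n + 1)) * Θ u k) →
    (∀ u, Z u = (∏ k, T u k) ^ (1 / ((n:ℝ) + 2))) →
    (∀ u, S u = ∑ j ∈ Finset.range (n + 2), (-1:ℝ) ^ j * u (Fin.last (n + 1)) ^ j *
      ∑ A ∈ Finset.powersetCard (j + 1) (Finset.univ : Finset (Fin (n + 2))), ∏ k ∈ A, Θ u k) →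
    (∀ u, H u = (∑ j ∈ Finset.range (n + 2), Z u ^ j) / S u) →
    (∀ u, K u = (∏ k, Θ u k) ^ ((s:ℝ) - 1)) →
    (∀ u k, M u k = (T u k) ^ (x:ℝ) * ∏ j : Fin (n + 1), (T u (k + j.succ)) ^ ((x:ℝ) + (((j:ℕ):ℝ) + 1) / ((n:ℝ) + 2) - 1)) →
    (∀ w, P w = (w (Fin.last (n + 2))) ^ (((n:ℝ) + 2) * (x:ℝ) - 1) *
      (1 - w (Fin.last (n + 2)) * Z (Fin.init w)) ^ (((n:ℝ) + 2) * (s:ℝ) - 1) * H (Fin.init w) ^ (((n:ℝ) + 2) * (s:ℝ)) * K (Fin.init w)) →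
    ∀ (Vθ : Fin (n + 1) → (Fin (n + 3) → ℝ) → ℝ) (Vy Vv : (Fin (n + 3) → ℝ) → ℝ), (∀ (i : Fin (n + 1)) w, Vθ i w = P w * (Fin.init w : Fin (n + 2) → ℝ) (Fin.castSucc i) *
      (∑ j, Θ (Fin.init w) j * (M (Fin.init w) i.succ - M (Fin.init w) j)) / (Fin.init w : Fin (n + 2) → ℝ) (Fin.last (n + 1))) →
    (∀ w, Vy w = P w * ∑ k, Θ (Fin.init w) k * M (Fin.init w) k) →
    (∀ w, Vv w = -(1 / ((n:ℝ) + 2) * (w (Fin.last (n + 2))) ^ (((n:ℝ) + 2) * (x:ℝ)) *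
      (1 - w (Fin.last (n + 2)) * Z (Fin.init w)) ^ (((n:ℝ) + 2) * (s:ℝ) - 1) * H (Fin.init w) ^ (((n:ℝ) + 2) * (s:ℝ) - 1) *
      K (Fin.init w) * ∑ k, M (Fin.init w) k / T (Fin.init w) k)) →
    ∀ w ∈ {w : Fin (n + 3) → ℝ | (Fin.init w : Fin (n + 2) → ℝ) ∈ {u : Fin (n + 2) → ℝ | (∀ i : Fin (n + 1), 0 < u (Fin.castSucc i)) ∧ ∑ i : Fin (n + 1), u (Fin.castSucc i) < 1 ∧ 0 < u (Fin.last (n + 1)) ∧ u (Fin.last (n + 1)) * (1 - ∑ i : Fin (n + 1), u (Fin.castSucc i)) < 1 ∧ ∀ i : Fin (n + 1), u (Fin.last (n + 1)) * u (Fin.castSucc i) < 1} ∧ 0 < w (Fin.last (n + 2)) ∧ w (Fin.last (n + 2)) < 1}, ∀ (dθ : Fin (n + 1) → ℝ) (dy dv : ℝ),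
      (∀ i, HasDerivAt (fun a => Vθ i (Function.update w (Fin.castSucc (Fin.castSucc i) : Fin (n + 3)) a)) (dθ i) (w (Fin.castSucc (Fin.castSucc i) : Fin (n + 3)))) →
      HasDerivAt (fun a => Vy (Function.update w (Fin.castSucc (Fin.last (n + 1)) : Fin (n + 3)) a)) dy (w (Fin.castSucc (Fin.last (n + 1)) : Fin (n + 3))) →
      HasDerivAt (fun a => Vv (Function.update w (Fin.last (n + 2)) a)) dv (w (Fin.last (n + 2))) →
      ∑ i, dθ i + dy - dv = 0 := by
  intro n x s hx hs Θ T Z S H K M P hΘ0 hΘs hT hZ hS hH hK hM hP Vθ Vy Vv hVθ hVy hVv w hw dθ dy dv hdθ hdy hdv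
  have hx0 : (0:ℚ) < x := by linarith
  have hs0 : (0:ℚ) < s := by linarith
  set p : ℝ := (n:ℝ) + 2 with hpdef
  have hp : 0 < p := by positivity
  -- coordinates and positivity
  set u : Fin (n + 2) → ℝ := Fin.init w with hudef
  set v : ℝ := w (Fin.last (n + 2)) with hvdef
  have hu : u ∈ {u : Fin (n + 2) → ℝ | (∀ i : Fin (n + 1), 0 < u (Fin.castSucc i)) ∧ ∑ i : Fin (n + 1), u (Fin.castSucc i) < 1 ∧ 0 < u (Fin.last (n + 1)) ∧ u (Fin.last (n + 1)) * (1 - ∑ i : Fin (n + 1), u (Fin.castSucc i)) < 1 ∧ ∀ i : Fin (n + 1), u (Fin.last (n + 1)) * u (Fin.castSucc i) < 1} := hw.1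
  have hv0 : 0 < v := hw.2.1
  have hv1 : v < 1 := hw.2.2
  set y : ℝ := u (Fin.last (n + 1)) with hydef
  have hy0 : 0 < y := hu.2.2.1
  have hT01 : ∀ k, 0 < T u k ∧ T u k < 1 := by
    intro k
    obtain ⟨hθpos, hθsum, -, hyθ0, hyθ⟩ := hu
    refine Fin.cases ?_ (fun i => ?_) k
    · rw [hT, hΘ0]
      exact ⟨by linarith, by nlinarith⟩
    · rw [hT, hΘs]
      exact ⟨by linarith [hyθ i], by nlinarith [hθpos i]⟩
  have hcube : ∀ k, T u k ∈ Set.Ioo (0:ℝ) 1 := fun k => hT01 k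
  have hZ01 : 0 < Z u ∧ Z u < 1 := by
    have hP0 : 0 < ∏ k, T u k := Finset.prod_pos fun k _ => (hT01 k).1
    have hP1 : ∏ k, T u k < 1 := by
      calc ∏ k, T u k < ∏ _k : Fin (n + 2), (1:ℝ) :=
            Finset.prod_lt_prod_of_nonempty (fun k _ => (hT01 k).1) (fun k _ => (hT01 k).2) Finset.univ_nonempty
        _ = 1 := by simp
    rw [hZ]
    exact ⟨Real.rpow_pos_of_pos hP0 _, Real.rpow_lt_one hP0.le hP1 (by positivity)⟩
  -- the flux field on the cube (step A)
  set ζt : (Fin (n + 2) → ℝ) → ℝ := fun t => (∏ i, t i) ^ (1 / p) with hζt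
  set Cf : (Fin (n + 2) → ℝ) → ℝ := fun t => ∏ i, (1 - t i) ^ ((s:ℝ) - 1) with hCf
  set Mt : (Fin (n + 2) → ℝ) → Fin (n + 2) → ℝ := fun t k => (t k) ^ (x:ℝ) *
    ∏ j : Fin (n + 1), (t (k + j.succ)) ^ ((x:ℝ) + (((j:ℕ):ℝ) + 1) / p - 1) with hMt
  set Yt : (Fin (n + 2) → ℝ) → Fin (n + 2) → ℝ := fun t k => 1 / p * (1 - t k) * (1 - ζt t) ^ (-(p * (s:ℝ))) *
    Cf t * Mt t k * ζt t ^ (-(p * (x:ℝ))) with hYt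
  obtain ⟨hdiffY, d, hdY, hsumd⟩ := cornerFieldGen n x s hx0 hs0 ζt Cf Mt Yt (fun _ => rfl) (fun _ => rfl)
    (fun _ _ => rfl) (fun _ _ => rfl) (T u) hcube
  set L : Fin (n + 2) → (Fin (n + 2) → ℝ) →L[ℝ] ℝ := fun k => fderiv ℝ (fun t' => Yt t' k) (T u) with hLdef
  have hL : ∀ k, HasFDerivAt (fun t' => Yt t' k) (L k) (T u) := fun k => (hdiffY k).hasFDerivAt
  have hLdiag : ∀ k, L k (Pi.single k 1) = d k := by
    intro k
    have h' : HasFDerivAt (fun t' => Yt t' k) (L k) (Function.update (T u) k (T u k)) := by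
      rw [Function.update_eq_self]; exact hL k
    exact (h'.comp_hasDerivAt (T u k) (hasDerivAt_update (T u) k (T u k))).unique (hdY k)
  set D0 : Fin (n + 2) → ℝ := fun k => L k (Pi.single 0 1) with hD0
  set Dm : Fin (n + 2) → Fin (n + 1) → ℝ := fun k i => L k (Pi.single i.succ 1) with hDm
  have hdiv : D0 0 + ∑ i, Dm i.succ i = 0 := by
    have h : ∑ k, L k (Pi.single k 1) = 0 := by
      rw [Finset.sum_congr rfl fun k _ => hLdiag k]; exact hsumd
    rwa [Fin.sum_univ_succ] at h
  -- the chart and the pulled-back field (steps B, C)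
  have hT0' : ∀ u', T u' 0 = 1 - u' (Fin.last (n + 1)) * (1 - ∑ j : Fin (n + 1), u' (Fin.castSucc j)) :=
    fun u' => by rw [hT, hΘ0]
  have hTs' : ∀ u' (j : Fin (n + 1)), T u' j.succ = 1 - u' (Fin.last (n + 1)) * u' (Fin.castSucc j) :=
    fun u' j => by rw [hT, hΘs]
  set Zk : Fin (n + 2) → (Fin (n + 2) → ℝ) → ℝ := fun k u' => Yt (T u') k with hZk
  have hθZ : ∀ k i, HasDerivAt (fun a => Zk k (Function.update u (Fin.castSucc i) a))
      (u (Fin.last (n + 1)) * D0 k - u (Fin.last (n + 1)) * Dm k i) (u (Fin.castSucc i)) :=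
    fun k i => DivPullback.hasDerivAt_comp_chart_theta T hT0' hTs' u (fun t' => Yt t' k) (L k) (hL k) i
  have hyZ : ∀ k, HasDerivAt (fun a => Zk k (Function.update u (Fin.last (n + 1)) a))
      (-((1 - ∑ i : Fin (n + 1), u (Fin.castSucc i)) * D0 k + ∑ i : Fin (n + 1), u (Fin.castSucc i) * Dm k i))
      (u (Fin.last (n + 1))) :=
    fun k => DivPullback.hasDerivAt_comp_chart_y T hT0' hTs' u (fun t' => Yt t' k) (L k) (hL k)
  set Yθ : Fin (n + 1) → (Fin (n + 2) → ℝ) → ℝ := fun i u' =>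
    (u' (Fin.last (n + 1))) ^ n * (Zk i.succ u' - u' (Fin.castSucc i) * ∑ k, Zk k u') with hYθ
  set Yy : (Fin (n + 2) → ℝ) → ℝ := fun u' => (u' (Fin.last (n + 1))) ^ (n + 1) * ∑ k, Zk k u' with hYy
  set Eθ : Fin (n + 1) → ℝ := fun i => (u (Fin.last (n + 1))) ^ n *
    ((u (Fin.last (n + 1)) * D0 i.succ - u (Fin.last (n + 1)) * Dm i.succ i) -
      (1 * ∑ k, Zk k u + u (Fin.castSucc i) * ∑ k, (u (Fin.last (n + 1)) * D0 k - u (Fin.last (n + 1)) * Dm k i)))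
    with hEθ
  set Ey : ℝ := ((n + 1 : ℕ) : ℝ) * (u (Fin.last (n + 1))) ^ n * ∑ k, Zk k u +
    (u (Fin.last (n + 1))) ^ (n + 1) * ∑ k, (-((1 - ∑ i : Fin (n + 1), u (Fin.castSucc i)) * D0 k +
      ∑ i : Fin (n + 1), u (Fin.castSucc i) * Dm k i)) with hEy
  have hadjθ : ∀ i, HasDerivAt (fun a => Yθ i (Function.update u (Fin.castSucc i) a)) (Eθ i) (u (Fin.castSucc i)) :=
    fun i => DivPullback.hasDerivAt_adjTheta u Zk i _ (fun k => hθZ k i)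
  have hadjy : HasDerivAt (fun a => Yy (Function.update u (Fin.last (n + 1)) a)) Ey (u (Fin.last (n + 1))) :=
    DivPullback.hasDerivAt_adjY u Zk _ hyZ
  have hdivadj : ∑ i, Eθ i + Ey = 0 := div_adj_eq_zero u Zk D0 Dm Eθ Ey hθZ hyZ hdiv hadjθ hadjy
  set Yf : Fin (n + 2) → (Fin (n + 2) → ℝ) → ℝ := fun j u' => Fin.lastCases (Yy u') (fun i => Yθ i u') j with hYf
  set dY : Fin (n + 2) → ℝ := fun j => Fin.lastCases Ey (fun i => Eθ i) j with hdY'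
  have hYfd : ∀ j, HasDerivAt (fun b => Yf j (Function.update u j b)) (dY j) (u j) := by
    intro j
    refine Fin.lastCases ?_ (fun i => ?_) j
    · simp only [hYf, hdY', Fin.lastCases_last]; exact hadjy
    · simp only [hYf, hdY', Fin.lastCases_castSucc]; exact hadjθ i
  have hsumY : ∑ j, dY j = 0 := by
    rw [Fin.sum_univ_castSucc]
    simp only [hdY', Fin.lastCases_castSucc, Fin.lastCases_last]
    exact hdivadj
  -- gradient of `Z` (explicit) and the `v`-extension data (step D)
  obtain ⟨zi, hzi, hziθ, hziy⟩ := cornerZetaGradGen n Θ T Z hΘ0 hΘs hT hZ u hu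
  set af : ℝ → ℝ := fun z => p * z ^ (p * (x:ℝ) - 1) * (1 - z) ^ (p * (s:ℝ) - 1) with haf'
  have hvZ : 0 < v * Z u ∧ v * Z u < 1 :=
    ⟨mul_pos hv0 hZ01.1, lt_of_lt_of_le (mul_lt_of_lt_one_right hv0 hZ01.2) hv1.le⟩
  have haf : HasDerivAt af (deriv af (v * Z u)) (v * Z u) := by
    refine DifferentiableAt.hasDerivAt ?_
    refine ((differentiableAt_const _).mul ?_).mul ?_
    · exact differentiableAt_id.rpow_const (Or.inl hvZ.1.ne')
    · exact ((differentiableAt_const (1:ℝ)).sub differentiableAt_id).rpow_const (Or.inl (sub_pos.mpr hvZ.2).ne')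
  -- identification (step E) and transfer of the three hypotheses
  have hident := fun u' (hu' : u' ∈ {u : Fin (n + 2) → ℝ | (∀ i : Fin (n + 1), 0 < u (Fin.castSucc i)) ∧ ∑ i : Fin (n + 1), u (Fin.castSucc i) < 1 ∧ 0 < u (Fin.last (n + 1)) ∧ u (Fin.last (n + 1)) * (1 - ∑ i : Fin (n + 1), u (Fin.castSucc i)) < 1 ∧ ∀ i : Fin (n + 1), u (Fin.last (n + 1)) * u (Fin.castSucc i) < 1}) =>
    cornerIdentGen n x s hx0 hs0 Θ T Z S H K M P hΘ0 hΘs hT hZ hS hH hK hM hP Yt (fun _ _ => rfl) u' hu'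
  have Hy : HasDerivAt (fun b => af (v * Z (Function.update u (Fin.last (n + 1)) b)) *
      Z (Function.update u (Fin.last (n + 1)) b) * Yf (Fin.last (n + 1)) (Function.update u (Fin.last (n + 1)) b))
      dy (u (Fin.last (n + 1))) := by
    refine hdy.congr_of_eventuallyEq ?_
    filter_upwards [eventually_update_mem hu (Fin.last (n + 1))] with b hb
    have hinit : Fin.init (Function.update w (Fin.castSucc (Fin.last (n + 1))) b) =
        Function.update u (Fin.last (n + 1)) b := Fin.init_update_castSucc ..
    have hlast : Function.update w (Fin.castSucc (Fin.last (n + 1))) b (Fin.last (n + 2)) = v :=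
      Function.update_of_ne (Fin.castSucc_lt_last _).ne' _ _
    rw [hVy, hP, hinit, hlast]
    simp only [hYf, Fin.lastCases_last, hYy, hZk]
    exact ((hident _ hb).1 v hv0).symm
  have Hθ : ∀ i : Fin (n + 1), HasDerivAt (fun b => af (v * Z (Function.update u (Fin.castSucc i) b)) *
      Z (Function.update u (Fin.castSucc i) b) * Yf (Fin.castSucc i) (Function.update u (Fin.castSucc i) b))
      (dθ i) (u (Fin.castSucc i)) := by
    intro i
    refine (hdθ i).congr_of_eventuallyEq ?_
    filter_upwards [eventually_update_mem hu (Fin.castSucc i)] with b hb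
    have hinit : Fin.init (Function.update w (Fin.castSucc (Fin.castSucc i)) b) =
        Function.update u (Fin.castSucc i) b := Fin.init_update_castSucc ..
    have hlast : Function.update w (Fin.castSucc (Fin.castSucc i)) b (Fin.last (n + 2)) = v :=
      Function.update_of_ne (Fin.castSucc_lt_last _).ne' _ _
    rw [hVθ, hP, hinit, hlast]
    simp only [hYf, Fin.lastCases_castSucc, hYθ, hZk]
    exact ((hident _ hb).2.1 v hv0 i).symm
  have hgrad : ∑ j, zi j * Yf j u = -(Z u * y ^ (n + 1) / p) * ∑ k, Yt (T u) k / T u k := by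
    have h := CornerZeta.grad_dot_adj (fun i => u (Fin.castSucc i)) (Θ u) (T u) (fun k => Zk k u)
      (Z u * y / p) y hy0.ne' (hΘ0 u) (fun i => hΘs u i)
    rw [Fin.sum_univ_castSucc]
    simp only [hYf, Fin.lastCases_castSucc, Fin.lastCases_last, hYθ, hYy, hZk, hziθ, hziy]
    have e1 : -(Z u / p) = -(Z u * y / p / y) := by field_simp
    have e2 : -(Z u * y ^ (n + 1) / p) = -(Z u * y / p * y ^ n) := by rw [pow_succ]; ring
    rw [e1, e2]
    convert h using 1
  have Hv : HasDerivAt (fun b => af (b * Z u) * b * ∑ j, zi j * Yf j u) dv v := by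
    refine hdv.congr_of_eventuallyEq ?_
    filter_upwards [Ioi_mem_nhds hv0] with b hb
    rw [hVv]
    simp only [Fin.init_update_last, Function.update_self]
    rw [hgrad]
    exact ((hident u hu).2.2 b hb).symm
  have hVu : ∀ j, HasDerivAt (fun b => af (v * Z (Function.update u j b)) * Z (Function.update u j b) *
      Yf j (Function.update u j b)) (Fin.lastCases dy (fun i => dθ i) j) (u j) := by
    intro j
    refine Fin.lastCases ?_ (fun i => ?_) j
    · simp only [Fin.lastCases_last]; exact Hy
    · simp only [Fin.lastCases_castSucc]; exact Hθ i
  have key := vext_eq_zero u v Z Yf af (deriv af (v * Z u)) zi dY (fun j => Fin.lastCases dy (fun i => dθ i) j) dv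
    hzi hYfd haf hsumY hVu Hv
  rw [Fin.sum_univ_castSucc] at key
  simpa only [Fin.lastCases_castSucc, Fin.lastCases_last] using key

end Summit.KontsevichZagierPeriods.TerasomaMultiplication.MultiplicationAccessible
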